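import Summits.BirchSwinnertonDyer.BirchSwinnertonDyer.Theorems.GenusKolyvaginAtTwoPowDvdShaCardAtTwoRTAuxiliaryClassDeep
import Summits.BirchSwinnertonDyer.BirchSwinnertonDyer.Theorems.GenusKolyvaginAtTwoPowDvdShaCardAtTwoRTLocalConjInvariance
import Summits.BirchSwinnertonDyer.BirchSwinnertonDyer.Theorems.GenusKolyvaginAtTwoPowDvdShaCardAtTwoRTUnramifiedParametrization
import Summits.BirchSwinnertonDyer.BirchSwinnertonDyer.Theorems.GenusKolyvaginAtTwoPowDvdShaCardAtTwoRTRegularFrameAtTwo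
import HarnessLib

/-!
# Route `GenusKolyvaginAtTwo`, crux L_T `PowDvdShaCardAtTwoRT` (stmt-BirchSwinnertonDyer-23242), LINE 18 stub KS, the DROPS —
# THE DEEP **EIGEN** AUXILIARY CLASS: McCallum's auxiliary class taken `τ`-EIGEN (either sign) AND DEEP (order `≥ 2^{⌈(L−2)/2⌉}`)

Seat `bsd-line-gk2-p5` g24 (cell `bsd-f1-sign2`, SUPPLY lineage), `--supports stmt-BirchSwinnertonDyer-23242` (helper; closes nothing).
THEOREMS ONLY (no definition, no named fact, no `sorry`).  BSD is NOT proved by any of this; neither is the crux nor any stub.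

WHY.  The DROPS of stub KS (the record-depth clause of McCallum's Prop. 5.2 at `p = 2`) run, at record depth `r ≥ 2`, on the deep
McCallum UP-swap (gk2-p2 g19, memo `Cruxes/PowDvdShaCardAtTwoRT/Lines/plus-descent-drops-guard-gk2p2.md` §3): reciprocity for the pair
`(c_L(nℓ₀ℓ′), c)` with an AUXILIARY class `c ∈ H¹(K, E[2^L])` that is (A) Kummer off the own primes `S`, transverse (any `σ_*`-stable
Lagrangian condition) at the places over `S ∖ ℓ₀`, free at `λ₀`, **`τ`-EIGEN of the sign `ε_{r+1}` of `c_L(nℓ₀ℓ′)`** (so that the pair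
Čebotarev `…RTFullOrderPairChebotarev` applies and the `λ′`-term loses exactly one bit, `…RTLocalEigenDuality`), and DEEP: of order
`2^e ≥ 2^{M_r+2}`.  gk2-p3 g19's `AuxiliaryClass.exists_mem_kummerOutside_addOrderOf_dvd_sq` (`…RTAuxiliaryClassDeep`) gives (A) + depth
WITHOUT the eigen condition; gk2-p4 g16's `exists_ne_zero_fixed_of_involutive` gives a `τ`-FIXED class without depth.  This file gives
both at once, for either sign, by one exponent trick on the Lagrangian reduction — no structure theory of `H¹(K_λ₀, E[2^L])`, no Klein.

MECHANISM (§1).  `R` coisotropic for a biadditive `b` (`{}^⊥R ≤ R`), `σ` an additive map with `b(σx, σy) = b(x, y)`, `ε = ±1`,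
`φ := id + ε σ`, `N :=` the exponent of `φ(R)`.  For `r ∈ R`, `N φ(r) = 0` says `σ(Nr) = −ε·Nr`; for any `y` with `σy = εy` the
invariance gives `b(y, Nr) = b(εy, −εNr) = −b(y, Nr)`, so `b(2N·y, r) = 0` on `R`, whence `2N·y ∈ R`, `φ(2N·y) = 4N·y ∈ φ(R)` is killed
by `N`: **`ord y ∣ 4N²`**, and `N = ord φ(r₀)` for some `r₀ ∈ R`.  With `y` an `ε`-eigen local class of order `2^L`: `ord φ(r₀) = 2^a`,
`L ≤ 2a + 2`.

* §1 `exists_mem_addOrderOf_dvd_four_mul_sq_eigen` (pure algebra), `_eq_pow_le` (the `2`-primary numeric form).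
* §2 `exists_mem_addOrderOf_dvd_four_mul_sq_eigen_eval` — product form over `LagrangianReduction.annLeft_map_eval_eq`.
* §3 `conjAct_mem_kummerOutside_of_forall_smul_eq` — `H¹_{𝓛, ⊤ on T}(K, E[n])` is `c_*`-stable when `c` fixes every place of `T`
  (`K` totally complex); **`exists_eigen_mem_kummerOutside_addOrderOf_dvd`** — setting of `…RTAuxiliaryClassDeep` for `E = W_K`, `W/ℚ`,
  `c ∈ Aut(K/ℚ)` an involution fixing the places of `S ∪ {w}`, `inv` conj-compatible, `e` semilinear for the adapted lift at `w`, the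
  `H_v` Lagrangian AND `σ_*`-stable, `y` an `ε`-eigen local class at `w`:  ∃ `x ∈ H¹_{𝓛, ⊤ on S∪{w}}` with `loc_v x ∈ H_v` (`v ∈ S`),
  **`c_* x = ε x`** and `ord y ∣ 4·ord(loc_w x)²`.
* §4 `exists_eigen_unramified_addOrderOf_eq_two_pow` — at a deep inert Kolyvagin place of the Heegner field on `Δ < 0` there IS an
  `ε`-eigen unramified local class of order `2^M` (`unr(Q₀ + ε τ̃_*Q₀)` on gk2-p3's regular frame), either sign.
* §5 **`exists_eigen_mem_kummerOutside_addOrderOf_eq_two_pow`** — the two assembled: the `ε`-eigen auxiliary class with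
  `ord(loc_w x) = 2^a`, `M ≤ 2a + 2` (so `ord x ≥ 2^a ≥ 2^{M_r+2}` once `M ≥ 2M_r + 6`).
HONEST FRAMING: closes nothing; the own-prime data (which `H_v`, the datum at `S`) and the Čebotarev/reciprocity steps are the integrator's.

References: [McCallumLMS1991] §2 Prop. 2.1 (proof, p. 300), §5 proof of Prop. 5.2 (p. 308 «we can add the further stipulation that
`c ∈ H¹(K, E_{p^M})^±`»); [MilneADT2006] I Thm. 4.10, Cor. 2.3; [GrossLMS1991] §5 (5.1); [Kolyvagin1991MathAnn] Thm. 2.1.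
-/

set_option autoImplicit false
-- the Theorems namespace of this sub repeats the summit name by design (D-0017 nested layout)
set_option linter.dupNamespace false

noncomputable section

open scoped Classical

open CategoryTheory Field NumberField IsDedekindDomain Function WeierstrassCurve
open Literature.NumberTheory.EllipticCurves
open Literature.NumberTheory.GaloisRepresentations
open Literature.NumberTheory.GaloisCohomology
open Literature.NumberTheory.Automorphic
open Summit.BirchSwinnertonDyer.Rank1Residual.X11b.KummerPT
open Summit.BirchSwinnertonDyer.Rank1Residual.X11b.FiniteDuality
open Summit.BirchSwinnertonDyer.Rank1Residual.X11b.Relaxation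
open Summit.BirchSwinnertonDyer.BirchSwinnertonDyer.Theorems.GenusExact.LagrangianReduction
open Summit.BirchSwinnertonDyer.BirchSwinnertonDyer.Theorems.GenusExact.PlusDescent
open scoped ContRepresentation

namespace Summit.BirchSwinnertonDyer.BirchSwinnertonDyer.Theorems.GenusExact.AuxiliaryClass

/-! ## §1 The exponent trick: an eigen-projection of a coisotropic subgroup is deep -/

section EigenDepth

variable {A : Type*} [AddCommGroup A] {C' : Type*} [AddCommGroup C']

/-- **Eigen-projections of a coisotropic subgroup are deep.**  `b` biadditive with values in any group, `R` finite with `{}^⊥R ≤ R`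
(every `a` with `b(a, r) = 0` for all `r ∈ R` lies in `R`), `σ : A →+ A` with `b(σx, σy) = b(x, y)`, `ε = ±1`, and `y` with `σy = εy`.
Then some `r ∈ R` has **`ord y ∣ 4 · ord(r + ε σr)²`**.  (With `N` the exponent of `(1 + εσ)(R)`: `N·R ⊆ ker(1 + εσ)` pairs with `y` into
the `2`-torsion, so `2N·y ∈ {}^⊥R ≤ R` and `(1 + εσ)(2N·y) = 4N·y` is killed by `N`.) [cite: McCallumLMS1991, §2 proof of Prop. 2.1, §5 p. 308] -/
theorem exists_mem_addOrderOf_dvd_four_mul_sq_eigen (b : A →+ A →+ C') (R : AddSubgroup A) [Finite R]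
    (hR : ∀ a : A, (∀ r ∈ R, b a r = 0) → a ∈ R) (σ : A →+ A) (hσb : ∀ x y, b (σ x) (σ y) = b x y)
    {ε : ℤ} (hε : ε = 1 ∨ ε = -1) {y : A} (hy : σ y = ε • y) :
    ∃ r ∈ R, addOrderOf y ∣ 4 * addOrderOf (r + ε • σ r) ^ 2 := by
  have hε2 : ε * ε = 1 := by rcases hε with rfl | rfl <;> norm_num
  -- `φ = id + ε σ`
  set φ : A →+ A := AddMonoidHom.id A + ε • σ with hφdef
  have hφ : ∀ x, φ x = x + ε • σ x := fun x ↦ rfl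
  -- the image `φ(R)` is finite; pick an element realising its exponent
  haveI : Finite (R.map φ) := Finite.of_surjective (fun r : R ↦ (⟨φ r, AddSubgroup.mem_map_of_mem φ r.2⟩ : R.map φ))
    (by rintro ⟨_, r, hr, rfl⟩; exact ⟨⟨r, hr⟩, rfl⟩)
  obtain ⟨z, hz⟩ := AddMonoid.exists_addOrderOf_eq_exponent (AddMonoid.ExponentExists.of_finite (G := R.map φ))
  obtain ⟨r₀, hr₀, hr₀z⟩ : ∃ r₀ ∈ R, φ r₀ = (z : A) := z.2
  set N := AddMonoid.exponent (R.map φ) with hNdef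
  have hN : ∀ r ∈ R, N • φ r = 0 := fun r hr ↦ by
    have h := AddMonoid.exponent_nsmul_eq_zero (G := R.map φ) ⟨φ r, AddSubgroup.mem_map_of_mem φ hr⟩
    exact congrArg Subtype.val h
  refine ⟨r₀, hr₀, ?_⟩
  -- `σ (N • r) = -(ε • N • r)` on `R`
  have h1 : ∀ r ∈ R, σ (N • r) = -(ε • (N • r)) := fun r hr ↦ by
    have h : N • r + ε • σ (N • r) = 0 := by rw [← hφ, map_nsmul]; exact hN r hr
    have h' : ε • σ (N • r) = -(N • r) := eq_neg_of_add_eq_zero_right h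
    have h'' := congrArg (fun t ↦ ε • t) h'
    simp only [smul_smul, hε2, one_zsmul, smul_neg] at h''
    exact h''
  -- `2 • b y (N • r) = 0`
  have h2 : ∀ r ∈ R, 2 • b y (N • r) = 0 := fun r hr ↦ by
    have e1 : b y (N • r) = -b y (N • r) := by
      conv_lhs => rw [← hσb, hy, h1 r hr]
      rw [map_zsmul, AddMonoidHom.zsmul_apply, map_neg, map_zsmul, smul_neg, smul_smul, hε2, one_zsmul]
    rw [two_nsmul]
    exact eq_neg_iff_add_eq_zero.mp e1
  -- `(2N) • y ∈ R`
  have h3 : (2 * N) • y ∈ R := hR _ fun r hr ↦ by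
    rw [map_nsmul, AddMonoidHom.nsmul_apply, mul_comm, mul_nsmul, ← map_nsmul]
    exact h2 r hr
  -- `φ y = 2 • y`, so `N • φ ((2N) • y) = (4 N²) • y = 0`
  have h4 : φ y = 2 • y := by rw [hφ, hy, smul_smul, hε2, one_zsmul, two_nsmul]
  have h5 : N • φ ((2 * N) • y) = 0 := hN _ h3
  rw [map_nsmul, h4, smul_smul, smul_smul] at h5
  have h6 : addOrderOf y ∣ N * (2 * N) * 2 := addOrderOf_dvd_of_nsmul_eq_zero h5
  have hN' : addOrderOf (r₀ + ε • σ r₀) = N := by rw [← hφ, hr₀z, AddSubgroup.addOrderOf_coe, hz]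
  rw [hN']
  convert h6 using 1
  ring

/-- **`2`-primary numeric form.**  If moreover `2^k` kills `A` and `ord y = 2^M`, some `r ∈ R` has `ord(r + εσr) = 2^a` with
**`M ≤ 2a + 2`** — the `ε`-eigen-projection of a Lagrangian in `H¹(K_λ, E[2^M])` reaches order `≥ 2^{⌈(M−2)/2⌉}`.
[cite: McCallumLMS1991, §2 Prop. 2.1 and §5 proof of Prop. 5.2] -/
theorem exists_mem_addOrderOf_eigen_eq_pow_le {k : ℕ} (hA : ∀ a : A, 2 ^ k • a = 0)
    (b : A →+ A →+ C') (R : AddSubgroup A) [Finite R] (hR : ∀ a : A, (∀ r ∈ R, b a r = 0) → a ∈ R)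
    (σ : A →+ A) (hσb : ∀ x y, b (σ x) (σ y) = b x y) {ε : ℤ} (hε : ε = 1 ∨ ε = -1) {y : A} (hy : σ y = ε • y)
    {M : ℕ} (hyM : addOrderOf y = 2 ^ M) :
    ∃ r ∈ R, ∃ a : ℕ, addOrderOf (r + ε • σ r) = 2 ^ a ∧ M ≤ 2 * a + 2 := by
  obtain ⟨r, hr, hdvd⟩ := exists_mem_addOrderOf_dvd_four_mul_sq_eigen b R hR σ hσb hε hy
  have hr' : addOrderOf (r + ε • σ r) ∣ 2 ^ k := addOrderOf_dvd_of_nsmul_eq_zero (hA _)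
  obtain ⟨a, -, hra⟩ := (Nat.dvd_prime_pow Nat.prime_two).mp hr'
  refine ⟨r, hr, a, hra, ?_⟩
  rw [hyM, hra, ← pow_mul, show (4 : ℕ) = 2 ^ 2 by norm_num, ← pow_add] at hdvd
  have h := (Nat.pow_dvd_pow_iff_le_right one_lt_two).mp hdvd
  omega

end EigenDepth

/-! ## §2 The product form: eigen-depth of the Lagrangian reduction to one coordinate -/

section Product

variable {ι : Type*} [Fintype ι] [DecidableEq ι] {X : ι → Type*} [∀ i, AddCommGroup (X i)] {n : ℕ}

/-- **Eigen-depth of the reduction («deep EIGEN Prop. 2.1», algebraic core).**  In the setting of `LagrangianReduction.annLeft_map_eval_eq`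
(`X_i` finite killed by `n`, perfect `b_i`, sum pairing `bP`, Lagrangian `G`, Lagrangian conditions `H_i` at `i ≠ w`), with an additive
`σ` on `X_w` preserving `b_w` and an `ε`-eigenvector `y ∈ X_w` (`ε = ±1`): there is `g ∈ G` with `g_i ∈ H_i` (`i ≠ w`) and
**`ord y ∣ 4 · ord(g_w + ε σ g_w)²`**. [cite: McCallumLMS1991, §2 Prop. 2.1 and §5 proof of Prop. 5.2] -/
theorem exists_mem_addOrderOf_dvd_four_mul_sq_eigen_eval [∀ i, Finite (X i)] [NeZero n] (hX : ∀ i (x : X i), n • x = 0)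
    (b : ∀ i, X i →+ X i →+ ZMod n) (hb : ∀ i, Injective (b i)) (hbflip : ∀ i, Injective (b i).flip)
    (bP : (∀ i, X i) →+ (∀ i, X i) →+ ZMod n) (hbP : ∀ x y, bP x y = ∑ i, b i (x i) (y i))
    (w : ι) (H : ∀ i, AddSubgroup (X i)) (hH : ∀ i, i ≠ w → annLeft (b i) (H i) = H i)
    (G : AddSubgroup (∀ i, X i)) (hG : annLeft bP G = G)
    (σ : X w →+ X w) (hσb : ∀ x y, b w (σ x) (σ y) = b w x y) {ε : ℤ} (hε : ε = 1 ∨ ε = -1)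
    {y : X w} (hy : σ y = ε • y) :
    ∃ g ∈ G, (∀ i, i ≠ w → g i ∈ H i) ∧ addOrderOf y ∣ 4 * addOrderOf (g w + ε • σ (g w)) ^ 2 := by
  set R := (G ⊓ AddSubgroup.pi {i | i ≠ w} H).map (Pi.evalAddMonoidHom X w) with hRdef
  haveI : Finite R := inferInstance
  have hR : ∀ a : X w, (∀ r ∈ R, b w a r = 0) → a ∈ R := fun a ha ↦ by
    have h : a ∈ annLeft (b w) R := (mem_annLeft_iff _ _ _).mpr ha
    rwa [annLeft_map_eval_eq hX b hb hbflip bP hbP w H hH G hG] at h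
  obtain ⟨r, hr, hdvd⟩ := exists_mem_addOrderOf_dvd_four_mul_sq_eigen (b w) R hR σ hσb hε hy
  obtain ⟨g, ⟨hgG, hgC⟩, rfl⟩ := hr
  refine ⟨g, hgG, fun i hi ↦ ?_, hdvd⟩
  have hgC' : g ∈ AddSubgroup.pi {i | i ≠ w} H := hgC
  exact (AddSubgroup.mem_pi _).mp hgC' i hi

end Product

/-! ## §3 Over the Heegner field: the `ε`-eigen auxiliary class -/

section Eigen

universe u

variable {K : Type} [Field K] [NumberField K] (W : WeierstrassCurve ℚ) [W.IsElliptic] (c : K ≃ₐ[ℚ] K) (p k : ℕ) [Fact p.Prime]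

omit [W.IsElliptic] in
/-- **`H¹_{𝓛, ⊤ on T}(K, E[n])` is `c_*`-stable** for `E = W_K` (`W/ℚ`), `K` with all infinite places complex and `c ∈ Aut(K/ℚ)` fixing
every place of `T` (the places of an imaginary quadratic `K` above inert rational primes, `c` = complex conjugation): `c_*` transports
the Kummer condition at `c⁻¹ v` onto the one at `v` (`conjAct_mem_selmerLocalKer_iff` along `galAdicCompletionEquiv`), the conditions
at the complex places are empty, and `c⁻¹ v ∉ T` when `v ∉ T`. [cite: GrossLMS1991, §5 (5.1)] [cite: MilneADT2006, Ch. I §6 (6.5)] -/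
theorem conjAct_mem_kummerOutside_of_forall_smul_eq (hK : ∀ w : InfinitePlace K, w.IsComplex) (n : ℕ)
    (T : Finset (HeightOneSpectrum (𝓞 K))) (hT : ∀ v ∈ T, c • v = v)
    {x : galoisCohomology ((W.baseChange K).torsionGaloisModule ((n : ℕ) : ℤ)) 1}
    (hx : x ∈ kummerOutside (W.baseChange K) n (T.map Function.Embedding.inr)) :
    (conjAct W c ((n : ℕ) : ℤ) x : galoisCohomology ((W.baseChange K).torsionGaloisModule ((n : ℕ) : ℤ)) 1) ∈
      kummerOutside (W.baseChange K) n (T.map Function.Embedding.inr) := by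
  rw [mem_kummerOutside_iff] at hx
  refine (mem_kummerOutside_iff (W.baseChange K) n _ _).mpr fun v hv ↦ ?_
  rcases v with w | w
  · -- complex place: the condition is empty
    haveI : IsAlgClosed w.Completion :=
      isAlgClosed_of_ringEquiv (InfinitePlace.Completion.ringEquivComplexOfIsComplex (hK w)).symm
    have h : conjAct W c ((n : ℕ) : ℤ) x ∈ selmerLocalKer (W.baseChange K) w.Completion ((n : ℕ) : ℤ) := by
      rw [WeierstrassCurve.selmerLocalKer_eq_top_of_isAlgClosed]; trivial
    rw [← (W.baseChange K).comap_res_kummerLocalConditionAt ((n : ℕ) : ℤ) w.Completion] at h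
    exact h
  · -- finite place `w ∉ T`: transport from `c⁻¹ • w ∉ T`
    have h : c • (c⁻¹ • w) = w := smul_inv_smul c w
    have hw' : (Sum.inr (c⁻¹ • w) : Place K) ∉ T.map Function.Embedding.inr := by
      intro hmem
      apply hv
      obtain ⟨v', hv'T, hv'eq⟩ := Finset.mem_map.mp hmem
      have hv'w : v' = c⁻¹ • w := Sum.inr_injective hv'eq
      have hw : w = v' := by rw [← h, ← hv'w, hT v' hv'T]
      rw [hw]
      exact Finset.mem_map_of_mem _ hv'T
    have hx' := hx _ hw'
    haveI : CharZero ((c⁻¹ • w).adicCompletion K) := charZero_of_injective_algebraMap (algebraMap K _).injective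
    haveI : CharZero (w.adicCompletion K) := charZero_of_injective_algebraMap (algebraMap K _).injective
    have h1 : x ∈ selmerLocalKer (W.baseChange K) ((c⁻¹ • w).adicCompletion K) ((n : ℕ) : ℤ) := by
      rw [← (W.baseChange K).comap_res_kummerLocalConditionAt ((n : ℕ) : ℤ) ((c⁻¹ • w).adicCompletion K)]
      exact hx'
    have h2 := (conjAct_mem_selmerLocalKer_iff W c (galAdicCompletionEquiv (L := K) c h)
      (isSemilinearRingEquiv_galAdicCompletionEquiv c h) ((n : ℕ) : ℤ) x).mpr h1
    rw [← (W.baseChange K).comap_res_kummerLocalConditionAt ((n : ℕ) : ℤ) (w.adicCompletion K)] at h2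
    exact h2

variable (e : (W.baseChange K).geomTorsion ((p ^ k : ℕ) : ℤ) → (W.baseChange K).geomTorsion ((p ^ k : ℕ) : ℤ) → AlgebraicClosure K)
  (hμ : ∀ S T, e S T ^ (p ^ k) = 1)
  (hadd₁ : ∀ S₁ S₂ T, e (S₁ + S₂) T = e S₁ T * e S₂ T)
  (hadd₂ : ∀ S T₁ T₂, e S (T₁ + T₂) = e S T₁ * e S T₂)
  (hgal : ∀ (γ : absoluteGaloisGroup K) (S T : (W.baseChange K).geomTorsion ((p ^ k : ℕ) : ℤ)),
    γ • e S T = e (γ • S) (γ • T))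
  (halt : ∀ T, e T T = 1) (hnondeg : ∀ T, (∀ S, e S T = 1) → T = 0)

include halt hnondeg in
/-- **THE DEEP `ε`-EIGEN AUXILIARY CLASS (divisibility form).**  Setting of `exists_mem_kummerOutside_addOrderOf_dvd_sq` for `E = W_K`
(`W/ℚ`, `K` totally complex, level `p^k`, Weil datum `e`, Poitou–Tate family `inv`, Tate's count), plus: `c ∈ Aut(K/ℚ)` an involution
fixing every place of `S ∪ {w}`, `inv` conj-compatible (`IsConjCompatible c`; the canonical family is), `e` semilinear for the adapted
lift at `w` (`hte`), the Lagrangian conditions `H_v` (`v ∈ S`) `σ_*`-STABLE, and an `ε`-eigen local class `y ∈ H¹(K_w, E[p^k])` (`σ_* y = εy`,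
`ε = ±1`).  Then there is `x ∈ H¹_{𝓛, ⊤ on S∪{w}}(K, E[p^k])` with `loc_v x ∈ H_v` (`v ∈ S`), **`c_* x = ε x`**, and **`ord y ∣ 4·ord(loc_w x)²`**.
Proof: §2 on the data of `…RTAuxiliaryClassDeep` with `σ = σ_*` at `w` (`invWeilPairing_conjActPlace_self`), then `x := x₀ + ε c_* x₀`
(`conjAct_mem_kummerOutside_of_forall_smul_eq`, `conjActPlace_localization_self`, `conjAct_conjAct_of_mul_self`).
[cite: McCallumLMS1991, §2 Prop. 2.1 and §5 proof of Prop. 5.2 (p. 308)] [cite: MilneADT2006, Ch. I Thm. 4.10] -/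
theorem exists_eigen_mem_kummerOutside_addOrderOf_dvd (hK : ∀ w : InfinitePlace K, w.IsComplex) (hc : c * c = 1)
    {inv : LocalInvariants K (p ^ k)} (hperf : inv.IsPerfect) (hsum : inv.SumLocalTermEqZero)
    (hcompl : inv.SelmerComplement) (hconj : inv.IsConjCompatible c)
    (hEuler : ∀ v : HeightOneSpectrum (𝓞 K),
      Nat.card (galoisCohomology (((W.baseChange K).torsionGaloisModule ((p ^ k : ℕ) : ℤ)).toLocal (Sum.inr v)) 1) =
        (Nat.card (nsmulAddMonoidHom (p ^ k) :
            ((W.baseChange K).baseChange (v.adicCompletion K)).toAffine.Point →+ _).ker *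
          Nat.card (v.adicCompletionIntegers K ⧸
            Ideal.span {((p ^ k : ℕ) : v.adicCompletionIntegers K)})) ^ 2)
    (S : Finset (HeightOneSpectrum (𝓞 K))) (w : HeightOneSpectrum (𝓞 K)) (hwS : w ∉ S)
    (hfixS : ∀ v ∈ S, c • v = v) (hw : c • w = w)
    (H : ∀ v : HeightOneSpectrum (𝓞 K),
      AddSubgroup (galoisCohomology (((W.baseChange K).torsionGaloisModule ((p ^ k : ℕ) : ℤ)).toLocal (Sum.inr v)) 1))
    (hH : ∀ v ∈ S, annLeft (invWeilPairing (W.baseChange K) (p ^ k) e hμ hadd₁ hadd₂ hgal inv (Sum.inr v)) (H v) = H v)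
    (hHc : ∀ v (hv : v ∈ S), ∀ X ∈ H v, conjActPlace W c ((p ^ k : ℕ) : ℤ) (hfixS v hv) X ∈ H v)
    (hte : ∀ S T, e ((isLiftOfAut_liftAutPlace c hw).torsionMap W ((p ^ k : ℕ) : ℤ) S)
      ((isLiftOfAut_liftAutPlace c hw).torsionMap W ((p ^ k : ℕ) : ℤ) T) = liftAutPlace c hw (e S T))
    {ε : ℤ} (hε : ε = 1 ∨ ε = -1)
    {y : galoisCohomology (((W.baseChange K).torsionGaloisModule ((p ^ k : ℕ) : ℤ)).toLocal (Sum.inr w)) 1}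
    (hy : conjActPlace W c ((p ^ k : ℕ) : ℤ) hw y = ε • y) :
    ∃ x ∈ kummerOutside (W.baseChange K) (p ^ k) ((insert w S).map Function.Embedding.inr),
      (∀ v ∈ S, galoisCohomology.localization ((W.baseChange K).torsionGaloisModule ((p ^ k : ℕ) : ℤ)) (Sum.inr v) 1 x ∈ H v) ∧
      conjAct W c ((p ^ k : ℕ) : ℤ) x = ε • x ∧
      addOrderOf y ∣
        4 * addOrderOf (galoisCohomology.localization ((W.baseChange K).torsionGaloisModule ((p ^ k : ℕ) : ℤ)) (Sum.inr w) 1 x) ^ 2 := by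
  classical
  haveI : NeZero (p ^ k) := ⟨pow_ne_zero k (Fact.out : p.Prime).ne_zero⟩
  have hε2 : ε * ε = 1 := by rcases hε with rfl | rfl <;> norm_num
  -- index type `T = S ∪ {w}`, coordinates, sum pairing (as in `…RTAuxiliaryClassDeep`)
  set X : ↥(insert w S) → Type := fun u ↦ galoisCohomology (((W.baseChange K).torsionGaloisModule ((p ^ k : ℕ) : ℤ)).toLocal
      (Sum.inr (u : HeightOneSpectrum (𝓞 K)))) 1 with hXdef
  obtain ⟨loc, hloc⟩ : ∃ loc : galoisCohomology ((W.baseChange K).torsionGaloisModule ((p ^ k : ℕ) : ℤ)) 1 →+ (∀ u, X u),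
      ∀ z u, loc z u = galoisCohomology.localization ((W.baseChange K).torsionGaloisModule ((p ^ k : ℕ) : ℤ))
        (Sum.inr (u : HeightOneSpectrum (𝓞 K))) 1 z :=
    ⟨AddMonoidHom.pi fun u ↦ galoisCohomology.localization ((W.baseChange K).torsionGaloisModule ((p ^ k : ℕ) : ℤ))
      (Sum.inr (u : HeightOneSpectrum (𝓞 K))) 1, fun z u ↦ rfl⟩
  haveI hfin : ∀ u : HeightOneSpectrum (𝓞 K), Finite (galoisCohomology
      (((W.baseChange K).torsionGaloisModule ((p ^ k : ℕ) : ℤ)).toLocal (Sum.inr u)) 1) :=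
    fun u ↦ finite_galoisCohomology_toLocal_inr (W.baseChange K) (p ^ k) u
  haveI : ∀ u : ↥(insert w S), Finite (X u) := fun u ↦ hfin u
  have hX : ∀ (u : ↥(insert w S)) (x : X u), (p ^ k) • x = 0 :=
    fun u x ↦ nsmul_galoisCohomology_toLocal_eq_zero (W.baseChange K) (p ^ k) _ x
  set b : ∀ u : ↥(insert w S), X u →+ X u →+ ZMod (p ^ k) :=
    fun u ↦ invWeilPairing (W.baseChange K) (p ^ k) e hμ hadd₁ hadd₂ hgal inv (Sum.inr (u : HeightOneSpectrum (𝓞 K))) with hbdef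
  have hb : ∀ u, Injective (b u) := fun u ↦
    (invWeilPairing_bijective (W.baseChange K) (p ^ k) e hμ hadd₁ hadd₂ hgal hnondeg inv (u : HeightOneSpectrum (𝓞 K))
      (hperf u).1.1).1
  have hbflip : ∀ u, Injective (b u).flip := fun u ↦
    (invWeilPairing_flip_bijective (W.baseChange K) (p ^ k) e hμ hadd₁ hadd₂ hgal hnondeg inv (u : HeightOneSpectrum (𝓞 K))
      (hperf u).1.1).1
  obtain ⟨bP, hbP⟩ := exists_piSum b
  -- `G` is Lagrangian
  have hG := annLeft_map_kummerOutside_eq (W.baseChange K) p k e hμ hadd₁ hadd₂ hgal halt hnondeg hK hperf hsum hcompl hEuler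
    (insert w S) loc hloc bP hbP
  -- reduction to the coordinate `w`
  set w' : ↥(insert w S) := ⟨w, Finset.mem_insert_self w S⟩ with hw'def
  set H' : ∀ u : ↥(insert w S), AddSubgroup (X u) := fun u ↦ H u with hH'def
  have hH' : ∀ u : ↥(insert w S), u ≠ w' → annLeft (b u) (H' u) = H' u := by
    intro u hu
    have huS : (u : HeightOneSpectrum (𝓞 K)) ∈ S := by
      rcases Finset.mem_insert.mp u.2 with h | h
      · exact absurd (Subtype.ext h) hu
      · exact h
    exact hH u huS
  -- `σ_*` at `w` preserves `b_w`
  set σ : X w' →+ X w' := conjActPlace W c ((p ^ k : ℕ) : ℤ) hw with hσdef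
  have hσb : ∀ x y, b w' (σ x) (σ y) = b w' x y :=
    invWeilPairing_conjActPlace_self W c (p ^ k) e hμ hadd₁ hadd₂ hgal hw hte inv hconj
  obtain ⟨g, hgG, hgH, hdvd⟩ := exists_mem_addOrderOf_dvd_four_mul_sq_eigen_eval hX b hb hbflip bP hbP w' H' hH'
    ((kummerOutside (W.baseChange K) (p ^ k) ((insert w S).map Function.Embedding.inr)).map loc) hG σ hσb hε hy
  obtain ⟨x₀, hx₀, rfl⟩ := hgG
  rw [hloc] at hdvd
  -- `c_*` as an endomorphism of `H¹(K, E[p^k])` in the `galoisCohomology` currency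
  obtain ⟨cA, hcA⟩ : ∃ cA : galoisCohomology ((W.baseChange K).torsionGaloisModule ((p ^ k : ℕ) : ℤ)) 1 →+
      galoisCohomology ((W.baseChange K).torsionGaloisModule ((p ^ k : ℕ) : ℤ)) 1,
      ∀ z, cA z = conjAct W c ((p ^ k : ℕ) : ℤ) z := ⟨conjAct W c ((p ^ k : ℕ) : ℤ), fun _ ↦ rfl⟩
  have hcc : cA (cA x₀) = x₀ := by
    rw [hcA, hcA]
    exact conjAct_conjAct_of_mul_self W hc _ x₀
  have hfixT : ∀ v ∈ insert w S, c • v = v := fun v hv ↦ by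
    rcases Finset.mem_insert.mp hv with rfl | hv
    · exact hw
    · exact hfixS v hv
  -- the eigen-projection `x = x₀ + ε c_* x₀`
  refine ⟨x₀ + ε • cA x₀, ?_, fun v hv ↦ ?_, ?_, ?_⟩
  · refine AddSubgroup.add_mem _ hx₀ (AddSubgroup.zsmul_mem _ ?_ ε)
    rw [hcA]
    exact conjAct_mem_kummerOutside_of_forall_smul_eq W c hK (p ^ k) (insert w S) hfixT hx₀
  · have hne : (⟨v, Finset.mem_insert_of_mem hv⟩ : ↥(insert w S)) ≠ w' := by
      intro h
      apply hwS
      have hv' : v = w := congrArg Subtype.val h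
      rwa [hv'] at hv
    have h' : galoisCohomology.localization ((W.baseChange K).torsionGaloisModule ((p ^ k : ℕ) : ℤ)) (Sum.inr v) 1 x₀ ∈
        H v := by
      have h := hgH ⟨v, Finset.mem_insert_of_mem hv⟩ hne
      rwa [hloc] at h
    rw [map_add, map_zsmul, hcA, ← conjActPlace_localization_self W c (p ^ k) (hfixS v hv) x₀]
    exact AddSubgroup.add_mem _ h' (AddSubgroup.zsmul_mem _ (hHc v hv _ h') ε)
  · have key : cA (x₀ + ε • cA x₀) = ε • (x₀ + ε • cA x₀) := by
      rw [map_add, map_zsmul, hcc, smul_add, smul_smul, hε2, one_zsmul, add_comm]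
    exact (hcA _).symm.trans key
  · rw [map_add, map_zsmul, hcA, ← conjActPlace_localization_self W c (p ^ k) hw x₀]
    exact hdvd

end Eigen

end Summit.BirchSwinnertonDyer.BirchSwinnertonDyer.Theorems.GenusExact.AuxiliaryClass

end
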